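import Summits.SmoothPoincare4.SmoothPoincare4.Theorems.ConvexBisectionAcyclicBisectionExistsStabilisationData
import Literature.Topology.FourManifolds.HandleAttachingMapsExistence
import HarnessLib

/-!
# N3 (`stub_STgeo`) ▸ N3-nat ▸ piece N3d-3 `node_rebase`: THE CONTRACT — the two-sided stabilised model
# from the HANDLEBODY SIDE with traces (B1), the CAP SIDE with traces (B2) and the GLUING ASSEMBLY (B3),
# kernel-checked
(wave 8, brick J7-4 of stub `stub_STgeo` = node N3 of NF4, line `modp-braid-orbits`, crux
`ConvexBisection.AcyclicBisectionExists`, item stmt-SmoothPoincare4-10508; registered sub-goal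
`helper_exists_blockModel`; design file `work/design/N3d_Pieces_Design.lean` (J7, wave 8) §B; the piece
text is the hypothesis `h3` of `StabilisationData.node_STnat_of_pieces` (`…StabilisationAngles.lean`, H6).)

Piece N3d-3 (`NormalisedDatum M g l S → (cancellations) → TwoSidedStabModel M g l S`) is cut along
the traces which the clauses (i)(ii)(iii) of `TwoSidedStabModel` consume (design finding F-J7-4):
* (B1) `piece3_handlebodySide` (`work/stubs/sig_piece3_handlebodySide.txt`): `X₁ = Base (g+1) ∪ qA ∪ qB ∪
  old⁗` with data `D₁` and `G_X : X₁ ≅ X` such that `G_X ∘ D₁.jA = D.jA ∘ Λ ∘ DV.jA` on base points of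
  the block model `V` (t1), `G_X ∘ D₁.jB (inl i) = D.jA ∘ Λ ∘ DV.jB i` (t2), `G_X ∘ D₁.jB (inr k) = D.jB k`
  (t3), plus the four link clauses of `hold` (landed: `StabHold.hold_link`);
* (B2) `piece3_capSide` (`sig_piece3_capSide.txt`): the cap-side copy `W₂` with data `D₂` over maps `q'`
  and `Ξ : W₂ ≅ Base g`, canonical off the model region (u-off), with `Ξ⁻¹ ∘ e ∘ Λ` read on seam points
  (u-seam, direction-preserving) and on the block handles (u-belt, the matching), and glue-compatibility
  (u-glue) — `e` the seam map of the datum;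
* (B3) `piece3_gluing` (`sig_piece3_gluing.txt`): from these, `M = X₁ ∪_ι W₂` (`ι := ∂Ξ⁻¹ ∘ Ψ ∘ ∂G_X`,
  two transfers) with the clauses of `TwoSidedStabModel`.
`node_rebase_of_subpieces` unpacks the normalised datum, takes ONE block model `V` (`exists_blockModel`,
Kosinski's simultaneous attachment of `![S.qA, S.qB]`) and its cancellation `Λ` (the piece's hypothesis),
and chains (B1), (B2), (B3).  No definitions.
References: J. B. Etnyre, T. Fuller, IMRN 2006, §2 [EtnyreFuller2006]; A. A. Kosinski, *Differential
Manifolds* (1993), VI §6–7 [Kosinski1993].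
-/

noncomputable section

-- the prescribed namespace `Summit.<P>.<Sub>.…` duplicates `SmoothPoincare4` (P = Sub)
set_option linter.dupNamespace false

open scoped Manifold ContDiff Topology Real
open Set Function

namespace Summit.SmoothPoincare4.SmoothPoincare4.Theorems.AcyclicBisectionExists.ModpBraidOrbits

open Literature.GroupTheory.CombinatorialGroupTheory.SignedHurwitz
open Literature.Topology.FourManifolds Literature.Topology.FourManifolds.LefschetzBase
open Literature.Topology.FourManifolds.HandleAttachingMap
open Literature.Geometry.Symplectic

namespace StabRebaseContract

/-! ## §1 A block model exists -/

/-- The block family `![S.qA, S.qB]` has pairwise disjoint ranges (`S.qAB_disjoint`). [folklore] -/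
theorem pairwise_disjoint_block {g n : ℕ} {c : Fin g ⊕ Fin g → ℤ} (S : StabBaseData g n c) :
    Pairwise fun i j => Disjoint (range (![S.qA, S.qB] i).toFun) (range (![S.qA, S.qB] j).toFun) := by
  intro i j hij
  fin_cases i <;> fin_cases j
  · exact absurd rfl hij
  · simpa using S.qAB_disjoint
  · simpa using S.qAB_disjoint.symm
  · exact absurd rfl hij

/-- A model `V` of `Base (g+1) ∪ qA ∪ qB` with data exists (Kosinski's simultaneous attachment).
[cite: Kosinski1993, VI §6] -/
theorem exists_blockModel {g n : ℕ} {c : Fin g ⊕ Fin g → ℤ} (S : StabBaseData g n c) :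
    ∃ (V : Type) (_ : TopologicalSpace V) (_ : T2Space V) (_ : SecondCountableTopology V)
      (_ : CompactSpace V) (_ : ChartedSpace (EuclideanHalfSpace 4) V) (_ : IsManifold (𝓡∂ 4) ∞ V),
      Nonempty (MultiAttachmentData ![S.qA, S.qB] (𝓡∂ 4) V) := by
  obtain ⟨P, _, _, _, hT2, h2nd, hcpt, hP⟩ := exists_isMultiAttachment_holds 3 2 (Base (g + 1))
    (Fin 2) ![S.qA, S.qB] (pairwise_disjoint_block S)
  exact ⟨P, inferInstance, hT2, h2nd, hcpt inferInstance, inferInstance, inferInstance,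
    hP.nonempty_multiAttachmentData⟩

/-! ## §2 The contract -/

/-- **CONTRACT N3d-3: `node_rebase` (text of `work/stubs/sig_node_rebase.txt`) from (B1), (B2), (B3)**
— PROVED: unpack the normalised datum, take ONE model `V` of the block pair (`exists_blockModel`) and
its cancellation `Λ` (hypothesis of the piece), run the handlebody side, the cap side, and the gluing
assembly. [cite: EtnyreFuller2006, §2] -/
theorem node_rebase_of_subpieces
    (hB1 : ∀ (g : ℕ) (l : IntWord g) (c : Fin g ⊕ Fin g → ℤ) (S : StabBaseData g l.length c)
        (X : Type) [TopologicalSpace X] [T2Space X] [SecondCountableTopology X] [CompactSpace X]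
        [ChartedSpace (EuclideanHalfSpace 4) X] [IsManifold (𝓡∂ 4) ∞ X]
        (h : Fin l.length → HandleAttachingMap 3 2 (Base g)) (D : MultiAttachmentData h (𝓡∂ 4) X),
        (∀ (i : Fin l.length) θ, (h i).attachingCircle θ ∈ page g (pageDir (l.length + 4) (i + 4))) →
        (∀ i, shadow g (h i).attachingCircle (h i).continuous_attachingCircle = (l.get i).1) →
        (∀ i, pageTwisting g (h i).attachingCircle (h i).attachingFraming = if (l.get i).2 then -1 else 1) →
        (∀ i y, w g ((h i).toFun y).1 ∉ blockSector l.length ∧ ‖cx ((h i).toFun y).1‖ ^ 2 < 4 - S.ε₁) →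
        ∀ (V : Type) [TopologicalSpace V] [T2Space V] [SecondCountableTopology V] [CompactSpace V]
          [ChartedSpace (EuclideanHalfSpace 4) V] [IsManifold (𝓡∂ 4) ∞ V]
          (DV : MultiAttachmentData ![S.qA, S.qB] (𝓡∂ 4) V) (Λ : V ≃ₘ⟮𝓡∂ 4, 𝓡∂ 4⟯ Base g),
        (∀ (a : ↥(coresComplement S.q1)) (ha : S.E.jA a ∈ coresComplement ![S.qA, S.qB]),
          (a : Base g) ∉ modelRegion g l.length S.δ₀ S.ε₁ → Λ (DV.jA ⟨S.E.jA a, ha⟩) = (a : Base g)) →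
        ∃ (X₁ : Type) (_ : TopologicalSpace X₁) (_ : T2Space X₁) (_ : SecondCountableTopology X₁)
          (_ : CompactSpace X₁) (_ : ChartedSpace (EuclideanHalfSpace 4) X₁) (_ : IsManifold (𝓡∂ 4) ∞ X₁)
          (hold : Fin l.length → HandleAttachingMap 3 2 (Base (g + 1)))
          (D₁ : MultiAttachmentData (Sum.elim ![S.qA, S.qB] hold) (𝓡∂ 4) X₁) (GX : X₁ ≃ₘ⟮𝓡∂ 4, 𝓡∂ 4⟯ X),
          (∀ (k : Fin l.length) θ, (hold k).attachingCircle θ ∈ page (g + 1) (pageDir (l.length + 4) (k + 4))) ∧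
          (∀ k, shadow (g + 1) (hold k).attachingCircle (hold k).continuous_attachingCircle =
            embed g (l.get k).1) ∧
          (∀ k, pageTwisting (g + 1) (hold k).attachingCircle (hold k).attachingFraming =
            if (l.get k).2 then -1 else 1) ∧
          (∀ k y, w (g + 1) ((hold k).toFun y).1 ∉ blockSector l.length) ∧
          (∀ (x : ↥(coresComplement ![S.qA, S.qB]))
            (hx : (x : Base (g + 1)) ∈ coresComplement (Sum.elim ![S.qA, S.qB] hold)),
            ∃ hΛ : Λ (DV.jA x) ∈ coresComplement h, GX (D₁.jA ⟨x, hx⟩) = D.jA ⟨Λ (DV.jA x), hΛ⟩) ∧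
          (∀ (i : Fin 2) (b : ↥(beltPiece 3 2)),
            ∃ hΛ : Λ (DV.jB i b) ∈ coresComplement h, GX (D₁.jB (Sum.inl i) b) = D.jA ⟨Λ (DV.jB i b), hΛ⟩) ∧
          (∀ (k : Fin l.length) (b : ↥(beltPiece 3 2)), GX (D₁.jB (Sum.inr k) b) = D.jB k b) )
    (hB2 : ∀ (g : ℕ) (l : IntWord g) (c : Fin g ⊕ Fin g → ℤ) (S : StabBaseData g l.length c)
        (X : Type) [TopologicalSpace X] [T2Space X] [SecondCountableTopology X] [CompactSpace X]
        [ChartedSpace (EuclideanHalfSpace 4) X] [IsManifold (𝓡∂ 4) ∞ X]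
        (h : Fin l.length → HandleAttachingMap 3 2 (Base g)) (D : MultiAttachmentData h (𝓡∂ 4) X)
        (bX : BoundaryData (𝓡∂ 4) X (𝓡 3)) (Ψ : bX.carrier ≃ₘ⟮𝓡 3, 𝓡 3⟯ (bBase g).carrier),
        (∀ (i : Fin l.length) θ, (h i).attachingCircle θ ∈ page g (pageDir (l.length + 4) (i + 4))) →
        (∀ i y, w g ((h i).toFun y).1 ∉ blockSector l.length ∧ ‖cx ((h i).toFun y).1‖ ^ 2 < 4 - S.ε₁) →
        (∀ (y : bX.carrier) (a : ↥(coresComplement h)), bX.incl y = D.jA a →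
          ∃ r : ℝ, 0 < r ∧ w g ((bBase g).incl (Ψ y)).1 = (r : ℂ) * w g (a : Base g).1) →
        (∀ (y : bX.carrier) (a : ↥(coresComplement h)), bX.incl y = D.jA a →
          4 - S.ε₁ < ‖cx (a : Base g).1‖ ^ 2 → (bBase g).incl (Ψ y) = (a : Base g)) →
        ∀ (V : Type) [TopologicalSpace V] [T2Space V] [SecondCountableTopology V] [CompactSpace V]
          [ChartedSpace (EuclideanHalfSpace 4) V] [IsManifold (𝓡∂ 4) ∞ V]
          (DV : MultiAttachmentData ![S.qA, S.qB] (𝓡∂ 4) V) (Λ : V ≃ₘ⟮𝓡∂ 4, 𝓡∂ 4⟯ Base g),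
        (∀ (a : ↥(coresComplement S.q1)) (ha : S.E.jA a ∈ coresComplement ![S.qA, S.qB]),
          (a : Base g) ∉ modelRegion g l.length S.δ₀ S.ε₁ → Λ (DV.jA ⟨S.E.jA a, ha⟩) = (a : Base g)) →
        ∃ (W₂ : Type) (_ : TopologicalSpace W₂) (_ : T2Space W₂) (_ : SecondCountableTopology W₂)
          (_ : CompactSpace W₂) (_ : ChartedSpace (EuclideanHalfSpace 4) W₂) (_ : IsManifold (𝓡∂ 4) ∞ W₂)
          (q' : Fin 2 → HandleAttachingMap 3 2 (Base (g + 1))) (D₂ : MultiAttachmentData q' (𝓡∂ 4) W₂)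
          (Ξ : W₂ ≃ₘ⟮𝓡∂ 4, 𝓡∂ 4⟯ Base g),
          (∀ (q : ↥(coresComplement S.q1)), (q : Base g) ∉ modelRegion g l.length S.δ₀ S.ε₁ →
            ∃ hq : S.E.jA q ∈ coresComplement q', Ξ (D₂.jA ⟨S.E.jA q, hq⟩) = (q : Base g)) ∧
          (∀ (x : ↥(coresComplement ![S.qA, S.qB])) (hΛ : Λ (DV.jA x) ∈ coresComplement h)
            (y₀ : bX.carrier), bX.incl y₀ = D.jA ⟨Λ (DV.jA x), hΛ⟩ →
            ∃ (a' : ↥(coresComplement q')) (r : ℝ), 0 < r ∧ Ξ.symm ((bBase g).incl (Ψ y₀)) = D₂.jA a' ∧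
              w (g + 1) (a' : Base (g + 1)).1 = (r : ℂ) * w (g + 1) (x : Base (g + 1)).1) ∧
          (∀ (i : Fin 2) (b : ↥(beltPiece 3 2)) (hΛ : Λ (DV.jB i b) ∈ coresComplement h) (y₀ : bX.carrier),
            bX.incl y₀ = D.jA ⟨Λ (DV.jB i b), hΛ⟩ → Ξ.symm ((bBase g).incl (Ψ y₀)) = D₂.jB i b) ∧
          (∀ (i : Fin 2) (b : ↥(beltPiece 3 2)), (∃ x', D₂.jA x' = D₂.jB i b) ↔ ∃ x, DV.jA x = DV.jB i b) )
    (hB3 : ∀ (M : Type) [TopologicalSpace M] [T2Space M] [SecondCountableTopology M]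
        [ChartedSpace (EuclideanSpace ℝ (Fin 4)) M] [IsManifold (𝓡 4) ∞ M]
        (g : ℕ) (l : IntWord g) (c : Fin g ⊕ Fin g → ℤ) (S : StabBaseData g l.length c)
        (X : Type) [TopologicalSpace X] [T2Space X] [SecondCountableTopology X] [CompactSpace X]
        [ChartedSpace (EuclideanHalfSpace 4) X] [IsManifold (𝓡∂ 4) ∞ X]
        (h : Fin l.length → HandleAttachingMap 3 2 (Base g)) (D : MultiAttachmentData h (𝓡∂ 4) X)
        (bX : BoundaryData (𝓡∂ 4) X (𝓡 3)) (Ψ : bX.carrier ≃ₘ⟮𝓡 3, 𝓡 3⟯ (bBase g).carrier),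
        (∀ (i : Fin l.length) θ, (h i).attachingCircle θ ∈ page g (pageDir (l.length + 4) (i + 4))) →
        (∀ i y, w g ((h i).toFun y).1 ∉ blockSector l.length ∧ ‖cx ((h i).toFun y).1‖ ^ 2 < 4 - S.ε₁) →
        IsBoundaryGluing bX (bBase g) Ψ (𝓡 4) M →
        (∀ (y : bX.carrier) (a : ↥(coresComplement h)), bX.incl y = D.jA a →
          ∃ r : ℝ, 0 < r ∧ w g ((bBase g).incl (Ψ y)).1 = (r : ℂ) * w g (a : Base g).1) →
        (∀ (y : bX.carrier) (a : ↥(coresComplement h)), bX.incl y = D.jA a →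
          4 - S.ε₁ < ‖cx (a : Base g).1‖ ^ 2 → (bBase g).incl (Ψ y) = (a : Base g)) →
        ∀ (V : Type) [TopologicalSpace V] [T2Space V] [SecondCountableTopology V] [CompactSpace V]
          [ChartedSpace (EuclideanHalfSpace 4) V] [IsManifold (𝓡∂ 4) ∞ V]
          (DV : MultiAttachmentData ![S.qA, S.qB] (𝓡∂ 4) V) (Λ : V ≃ₘ⟮𝓡∂ 4, 𝓡∂ 4⟯ Base g),
        (∀ (a : ↥(coresComplement S.q1)) (ha : S.E.jA a ∈ coresComplement ![S.qA, S.qB]),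
          (a : Base g) ∉ modelRegion g l.length S.δ₀ S.ε₁ → Λ (DV.jA ⟨S.E.jA a, ha⟩) = (a : Base g)) →
        ∀ (X₁ : Type) [TopologicalSpace X₁] [T2Space X₁] [SecondCountableTopology X₁] [CompactSpace X₁]
          [ChartedSpace (EuclideanHalfSpace 4) X₁] [IsManifold (𝓡∂ 4) ∞ X₁]
          (hold : Fin l.length → HandleAttachingMap 3 2 (Base (g + 1)))
          (D₁ : MultiAttachmentData (Sum.elim ![S.qA, S.qB] hold) (𝓡∂ 4) X₁) (GX : X₁ ≃ₘ⟮𝓡∂ 4, 𝓡∂ 4⟯ X),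
        (∀ (k : Fin l.length) θ, (hold k).attachingCircle θ ∈ page (g + 1) (pageDir (l.length + 4) (k + 4))) →
        (∀ k, shadow (g + 1) (hold k).attachingCircle (hold k).continuous_attachingCircle =
          embed g (l.get k).1) →
        (∀ k, pageTwisting (g + 1) (hold k).attachingCircle (hold k).attachingFraming =
          if (l.get k).2 then -1 else 1) →
        (∀ k y, w (g + 1) ((hold k).toFun y).1 ∉ blockSector l.length) →
        (∀ (x : ↥(coresComplement ![S.qA, S.qB]))
          (hx : (x : Base (g + 1)) ∈ coresComplement (Sum.elim ![S.qA, S.qB] hold)),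
          ∃ hΛ : Λ (DV.jA x) ∈ coresComplement h, GX (D₁.jA ⟨x, hx⟩) = D.jA ⟨Λ (DV.jA x), hΛ⟩) →
        (∀ (i : Fin 2) (b : ↥(beltPiece 3 2)),
          ∃ hΛ : Λ (DV.jB i b) ∈ coresComplement h, GX (D₁.jB (Sum.inl i) b) = D.jA ⟨Λ (DV.jB i b), hΛ⟩) →
        (∀ (k : Fin l.length) (b : ↥(beltPiece 3 2)), GX (D₁.jB (Sum.inr k) b) = D.jB k b) →
        ∀ (W₂ : Type) [TopologicalSpace W₂] [T2Space W₂] [SecondCountableTopology W₂] [CompactSpace W₂]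
          [ChartedSpace (EuclideanHalfSpace 4) W₂] [IsManifold (𝓡∂ 4) ∞ W₂]
          (q' : Fin 2 → HandleAttachingMap 3 2 (Base (g + 1))) (D₂ : MultiAttachmentData q' (𝓡∂ 4) W₂)
          (Ξ : W₂ ≃ₘ⟮𝓡∂ 4, 𝓡∂ 4⟯ Base g),
        (∀ (q : ↥(coresComplement S.q1)), (q : Base g) ∉ modelRegion g l.length S.δ₀ S.ε₁ →
          ∃ hq : S.E.jA q ∈ coresComplement q', Ξ (D₂.jA ⟨S.E.jA q, hq⟩) = (q : Base g)) →
        (∀ (x : ↥(coresComplement ![S.qA, S.qB])) (hΛ : Λ (DV.jA x) ∈ coresComplement h)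
          (y₀ : bX.carrier), bX.incl y₀ = D.jA ⟨Λ (DV.jA x), hΛ⟩ →
          ∃ (a' : ↥(coresComplement q')) (r : ℝ), 0 < r ∧ Ξ.symm ((bBase g).incl (Ψ y₀)) = D₂.jA a' ∧
            w (g + 1) (a' : Base (g + 1)).1 = (r : ℂ) * w (g + 1) (x : Base (g + 1)).1) →
        (∀ (i : Fin 2) (b : ↥(beltPiece 3 2)) (hΛ : Λ (DV.jB i b) ∈ coresComplement h) (y₀ : bX.carrier),
          bX.incl y₀ = D.jA ⟨Λ (DV.jB i b), hΛ⟩ → Ξ.symm ((bBase g).incl (Ψ y₀)) = D₂.jB i b) →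
        (∀ (i : Fin 2) (b : ↥(beltPiece 3 2)), (∃ x', D₂.jA x' = D₂.jB i b) ↔ ∃ x, DV.jA x = DV.jB i b) →
        TwoSidedStabModel M g l S ) :
    ∀ (M : Type) [TopologicalSpace M] [T2Space M] [SecondCountableTopology M]
      [ChartedSpace (EuclideanSpace ℝ (Fin 4)) M] [IsManifold (𝓡 4) ∞ M] (g : ℕ) (l : IntWord g)
      (c : Fin g ⊕ Fin g → ℤ) (S : StabBaseData g l.length c),
      NormalisedDatum M g l S →
      (∀ (V : Type) [TopologicalSpace V] [T2Space V] [SecondCountableTopology V] [CompactSpace V]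
        [ChartedSpace (EuclideanHalfSpace 4) V] [IsManifold (𝓡∂ 4) ∞ V]
        (DV : MultiAttachmentData ![S.qA, S.qB] (𝓡∂ 4) V),
        ∃ Λ : V ≃ₘ⟮𝓡∂ 4, 𝓡∂ 4⟯ Base g,
          ∀ (a : ↥(coresComplement S.q1)) (ha : S.E.jA a ∈ coresComplement ![S.qA, S.qB]),
            (a : Base g) ∉ modelRegion g l.length S.δ₀ S.ε₁ → Λ (DV.jA ⟨S.E.jA a, ha⟩) = (a : Base g)) →
      TwoSidedStabModel M g l S := by
  intro M _ _ _ _ _ g l c S hN hcancel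
  obtain ⟨X, _, _, _, _, _, _, h, D, bX, Ψ, h1, h2, h3, h4, h5, h6, h7⟩ := hN
  obtain ⟨V, _, _, _, _, _, _, ⟨DV⟩⟩ := exists_blockModel S
  obtain ⟨Λ, hΛ⟩ := hcancel V DV
  obtain ⟨X₁, _, _, _, _, _, _, hold, D₁, GX, k1, k2, k3, k4, t1, t2, t3⟩ :=
    hB1 g l c S X h D h1 h2 h3 h4 V DV Λ hΛ
  obtain ⟨W₂, _, _, _, _, _, _, q', D₂, Ξ, u1, u2, u3, u4⟩ := hB2 g l c S X h D bX Ψ h1 h4 h6 h7 V DV Λ hΛ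
  exact hB3 M g l c S X h D bX Ψ h1 h4 h5 h6 h7 V DV Λ hΛ X₁ hold D₁ GX k1 k2 k3 k4 t1 t2 t3
    W₂ q' D₂ Ξ u1 u2 u3 u4

end StabRebaseContract

/-! ## Registered helper -/

/-- **Registered helper `helper_exists_blockModel` (sub-goal of `stub_STgeo` ▸ N3-nat ▸ N3d-3, wave 8, lead
c5): a model of `Base (g+1) ∪ qA ∪ qB` with multi-attachment data exists.** [cite: Kosinski1993, VI §6] -/
theorem helper_exists_blockModel : ∀ (g n : ℕ) (c : Fin g ⊕ Fin g → ℤ) (S : Summit.SmoothPoincare4.SmoothPoincare4.Theorems.AcyclicBisectionExists.ModpBraidOrbits.StabBaseData g n c), ∃ (V : Type) (_ : TopologicalSpace V) (_ : T2Space V) (_ : SecondCountableTopology V) (_ : CompactSpace V) (_ : ChartedSpace (EuclideanHalfSpace 4) V) (_ : IsManifold (𝓡∂ 4) ∞ V), Nonempty (Literature.Topology.FourManifolds.HandleAttachingMap.MultiAttachmentData ![S.qA, S.qB] (𝓡∂ 4) V) :=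
  fun _ _ _ S => StabRebaseContract.exists_blockModel S

end Summit.SmoothPoincare4.SmoothPoincare4.Theorems.AcyclicBisectionExists.ModpBraidOrbits

end
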